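import Summits.ABC.ABC.Theses.DefiniteXi
import Literature.NumberTheory.EllipticCurves.TakahashiDegreeFormula
import Literature.NumberTheory.EllipticCurves.PastenSpectralDegree
import Literature.NumberTheory.EllipticCurves.PastenHeightBounds
import Literature.NumberTheory.EllipticCurves.PastenValuationProductTamagawaProofs
import Literature.NumberTheory.Automorphic.BrandtEigenvectorDegreeZero
import Literature.NumberTheory.Automorphic.EichlerSubidealCount
import Literature.NumberTheory.Automorphic.DefiniteOrderUnitsFinite
import HarnessLib

/-!
# Crux `DefiniteXi.DefiniteRTControlPrime` (stmt-ABC-11338) — ideator-1 sketch (round 1)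

Two first lemmas, one per idea card:

* Card `optimal-pivot-spine`: `definiteRTControlPrime_of_facts` — the crux from three vendored
  named facts (Takahashi 2001 Thm 2.3 at `r ∥ N`, the Mazur–Kenku `163` degree transport, Pasten's
  Lemma 6.8 valuation transport). STATEMENT ONLY here (`sorry`); the proof is bookkeeping over tree
  theorems listed on the card.
* Card `monodromy-package-lemma`: `abstract_takahashi` (PROVED) — Takahashi's `δ·i = h·j`,
  `i j = c`, `i ∣ h` is pure arithmetic once the monodromy package (functoriality + adjunction of
  Grothendieck's pairing + surjectivity of `X(J) → X(E)` for the optimal sub-curve) is granted;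
  `MonodromyPackage` states that package over the tree's Brandt vocabulary, and
  `takahashi_of_monodromyPackage` (PROVED) shows it implies the vendored fact
  `takahashi2001_thm_2_3_of_coprime` verbatim.
-/

set_option linter.dupNamespace false

noncomputable section

open scoped BigOperators

namespace Summit.ABC.ABC.Cruxes.DefiniteRTControlPrime.Sketch

open Literature.NumberTheory.EllipticCurves Literature.NumberTheory.EllipticCurves.ModularForms
open Literature.NumberTheory.Automorphic Literature.NumberTheory.Automorphic.Brandt

/-! ## Card `optimal-pivot-spine`: first lemma (statement) -/

/-- **The crux from three vendored facts.** Pivot to the class-optimal datum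
(`ModularParametrizationData.exists_optimalDatum'`), apply Takahashi at `(M, r) = (N/q, q)`
(`q ∥ N` for Frey curves by `isSemistableAt_freyCurve_holds`; setup existence by
`Brandt.nonempty_xiSetup_iff_admissible`), and return to the Frey model by the degree transport
(`163`-fact, after `nonempty_modularParametrizationData_of_smul` to a global minimal model, factor
`4`) and the valuation transport (Lemma 6.8, factor `163`); `C = 4 · 163 · 163`, `N^ε` idle. -/
theorem definiteRTControlPrime_of_facts
    (hT : takahashi2001_thm_2_3_of_coprime)
    (h163 : PastenShimura2024_minimalDegree_le_163_mul)
    (h68 : PastenShimura2024_lemma_6_8) :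
    Summit.ABC.ABC.Theses.DefiniteXi.DefiniteRTControlPrime := by
  sorry

/-! ## Card `monodromy-package-lemma`: the abstract Takahashi lemma (PROVED) -/

/-- Pure arithmetic core of Takahashi 2001, Thm 2.3: if `m² h = c δ`, `c = m t` and `c ∣ m h`
with `m ≠ 0`, then `δ t = h m` and `t ∣ h`. -/
theorem core {h δ c m t : ℤ} (hm : m ≠ 0) (h1 : m * m * h = c * δ) (h2 : c = m * t)
    (h3 : c ∣ m * h) : δ * t = h * m ∧ t ∣ h := by
  subst h2
  refine ⟨?_, ?_⟩
  · have key : m * (m * h) = m * (t * δ) := by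
      rw [← mul_assoc, h1]; ring
    have key' : m * h = t * δ := mul_left_cancel₀ hm key
    calc δ * t = t * δ := mul_comm _ _
      _ = m * h := key'.symm
      _ = h * m := mul_comm _ _
  · obtain ⟨k, hk⟩ := h3
    have key : m * h = m * (t * k) := by rw [hk]; ring
    exact ⟨k, mul_left_cancel₀ hm key⟩

variable {ι : Type*} [Fintype ι]

/-- The Gross / monodromy pairing `⟨x, y⟩ = Σ_i w_i x_i y_i` on `ℤ^ι`. -/
def pair (w : ι → ℕ) (x y : ι → ℤ) : ℤ := ∑ i, (w i : ℤ) * x i * y i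

theorem pair_smul_right (w : ι → ℕ) (x g : ι → ℤ) (m : ℤ) :
    pair w x (m • g) = m * pair w x g := by
  unfold pair
  rw [Finset.mul_sum]
  refine Finset.sum_congr rfl fun i _ => ?_
  simp only [Pi.smul_apply, smul_eq_mul]
  ring

theorem pair_smul_left (w : ι → ℕ) (g y : ι → ℤ) (m : ℤ) :
    pair w (m • g) y = m * pair w g y := by
  unfold pair
  rw [Finset.mul_sum]
  refine Finset.sum_congr rfl fun i _ => ?_
  simp only [Pi.smul_apply, smul_eq_mul]
  ring

/-- `⟨g, g⟩ = Σ w_i |g_i|²` (the tree's `Brandt.xi` of the line `ℤ g`, cast to `ℤ`). -/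
theorem pair_self_eq_natCast (w : ι → ℕ) (g : ι → ℤ) :
    pair w g g = ((∑ i, w i * (g i).natAbs ^ 2 : ℕ) : ℤ) := by
  unfold pair
  push_cast
  refine Finset.sum_congr rfl fun i _ => ?_
  rw [pow_two, abs_mul_abs_self]
  ring

/-- **Abstract Takahashi lemma** (the linear algebra of Takahashi 2001, Lemma 2.1–2.2 and
Thm 2.3, with the monodromy package as hypotheses). Let `ν = m • g` (`g` a generator of the
`f`-eigen-line of the character group `X`, `ν` the image of the generator of `X(E) = ℤ`), and let
`c` (`= ord_q Δ_min`, the thickness of `E`'s node) and `δ` (the modular degree) satisfy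
(i) `⟨ν, ν⟩ = c δ` (adjunction `u_J(π^*1, π^*1) = u_E(1, X(ππ^∨)1) = c δ`),
(ii) `c ∣ ⟨g, ν⟩` (the functional `λ = ⟨·, ν⟩ / c = X(π^∨)` is integral),
(iii) `⟨x₀, ν⟩ = c` for some `x₀` (`λ` is onto: `X(J) → X(E)` is surjective for the optimal
sub-curve, Bosch–Lütkebohmert–Raynaud 7.5/4). Then with `t := ⟨x₀, g⟩` one has `c = m t`,
`δ t = ⟨g, g⟩ m` and `t ∣ ⟨g, g⟩` — i.e. Takahashi's `i := |t|`, `j := |m|`: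
`i j = c`, `δ i = h j`, `i ∣ h`. No sorry. -/
theorem abstract_takahashi (w : ι → ℕ) (g : ι → ℤ) (m c δ : ℤ) (hc : c ≠ 0)
    (hνν : pair w (m • g) (m • g) = c * δ)
    (hdiv : c ∣ pair w g (m • g))
    (hsurj : ∃ x₀, pair w x₀ (m • g) = c) :
    ∃ t : ℤ, c = m * t ∧ δ * t = pair w g g * m ∧ t ∣ pair w g g := by
  obtain ⟨x₀, hx₀⟩ := hsurj
  rw [pair_smul_right] at hx₀
  have hm : m ≠ 0 := by
    rintro rfl
    exact hc (by rw [← hx₀, zero_mul])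
  refine ⟨pair w x₀ g, hx₀.symm, ?_⟩
  refine core hm ?_ hx₀.symm ?_
  · rw [pair_smul_left, pair_smul_right, ← mul_assoc] at hνν
    exact hνν
  · rw [pair_smul_right, mul_comm] at hdiv
    rwa [mul_comm]

/-! ## Card `monodromy-package-lemma`: the structural fact and its comparison with the tree -/

/-- **Monodromy package for the optimal quotient of `J₀(Mq)` at a prime `q ∥ Mq`** (the named
fact the card proposes to vendor in place of Takahashi's conclusion). For `W/ℚ` the
`X₀(Mq)`-optimal curve (datum `P` minimal among the data, at level `Mq`, of the conductor-`Mq`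
curves with the same newform), `gcd(M, q) = 1`, and every Brandt setup `S` of type `(M, q)`:
the `a(W)`-eigen-lattice of the Brandt matrices is a line `ℤ g` (Jacquet–Langlands and
multiplicity one), and there is an integer `m` (so that `ν = m g = π^*(1_{X(E)})`, the image of
the generator of the character group of `E` at `q` in `X_q(J₀(Mq)) = ℤ[Cls O]⁰`, Ribet 1990 §3 /
Deligne–Rapoport) with: `⟨ν, ν⟩_w = c · δ` (`c = ord_q Δ_min(W)`, `δ = deg`; Grothendieck SGA7 IX:
functoriality and adjunction of the monodromy pairing, `X(π π^∨) = δ`), `c ∣ ⟨x, ν⟩_w` for every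
degree-zero `x` (integrality of `X(π^∨) = ⟨·, ν⟩/c`), and `⟨x₀, ν⟩_w = c` for some degree-zero `x₀`
(surjectivity of `X(J) → X(E)` for the optimal abelian subvariety `E ↪ J`, BLR *Néron models*
Thm 7.5.4). -/
def MonodromyPackage : Prop :=
  ∀ (W : WeierstrassCurve ℚ) [W.IsElliptic] (M q : ℕ) [NeZero (M * q)],
    q.Prime → M.Coprime q → W.conductorNorm ℤ = M * q →
    ∀ P : ModularParametrizationData W (M * q),
      (∀ (W' : WeierstrassCurve ℚ) [W'.IsElliptic], W'.conductorNorm ℤ = M * q →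
          ∀ P' : ModularParametrizationData W' (M * q),
          P'.f = P.f → P.modularDegree ≤ P'.modularDegree) →
      ∀ (S : Brandt.XiSetup M q) [Fintype (Brandt.ClassSet S.O)],
        ∃ (g : Brandt.ClassSet S.O → ℤ) (m : ℤ),
          g ≠ 0 ∧
          Brandt.eigenLattice (M * q) (Brandt.matrix S.O) (fun n => W.LFunction n) = ℤ ∙ g ∧
          pair (Brandt.weight S.O) (m • g) (m • g) =
            ((W.minimalDiscriminantNorm ℤ).factorization q : ℤ) * P.modularDegree ∧
          (∀ x : Brandt.ClassSet S.O → ℤ, ∑ i, x i = 0 →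
            ((W.minimalDiscriminantNorm ℤ).factorization q : ℤ) ∣ pair (Brandt.weight S.O) x (m • g)) ∧
          (∃ x₀ : Brandt.ClassSet S.O → ℤ, ∑ i, x₀ i = 0 ∧
            pair (Brandt.weight S.O) x₀ (m • g) = (W.minimalDiscriminantNorm ℤ).factorization q)

/-- **The package implies the vendored fact** `takahashi2001_thm_2_3_of_coprime` verbatim
(so vendoring the package costs nothing downstream). Ingredients beyond `abstract_takahashi`:
`Σ g_i = 0` for Brandt eigenvectors of `a(E)` (tree: Eichler column sums
`XiSetup.sum_matrix_prime_eq` + `Brandt.sum_eq_zero_of_mem_eigenLattice_lFunction`),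
`ξ_S = Σ w_i g_i²` (`xiOfOrder_eq`, `xi_eq_sum`), and `c = ord_q Δ_min ≥ 1` because `q` divides
the conductor (`primeFactors_conductorNorm_eq`). -/
theorem takahashi_of_monodromyPackage (hP : MonodromyPackage) :
    takahashi2001_thm_2_3_of_coprime := by
  intro W _ M q _ hq hMq hN P hmin S
  classical
  letI : Fintype (Brandt.ClassSet S.O) := Fintype.ofFinite _
  obtain ⟨g, m, hg0, hL, hνν, hdiv, x₀, hx₀sum, hx₀⟩ := hP W M q hq hMq hN P hmin S
  set c : ℕ := (W.minimalDiscriminantNorm ℤ).factorization q with hc_def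
  -- `c ≥ 1`: `q` is a bad prime
  have hc : c ≠ 0 := by
    have hqN : q ∈ (W.conductorNorm ℤ).primeFactors := by
      rw [Nat.mem_primeFactors]
      exact ⟨hq, hN ▸ dvd_mul_left q M, hN ▸ NeZero.ne (M * q)⟩
    rw [primeFactors_conductorNorm_eq W, ← Nat.support_factorization] at hqN
    exact Finsupp.mem_support_iff.mp hqN
  -- `Σ g_i = 0`
  have hgmem : g ∈ Brandt.eigenLattice (M * q) (Brandt.matrix S.O) (fun n => W.LFunction n) := by
    rw [hL]; exact Submodule.mem_span_singleton_self g
  obtain ⟨p, hpge, hp⟩ := Nat.exists_infinite_primes (M * q + 1)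
  have hpN : ¬ p ∣ M * q := fun h => by
    have := Nat.le_of_dvd (Nat.pos_of_ne_zero (NeZero.ne (M * q))) h
    omega
  have hgsum : ∑ i, g i = 0 :=
    Brandt.sum_eq_zero_of_mem_eigenLattice_lFunction W hgmem hp hpN
      (fun j => S.sum_matrix_prime_eq hp hpN j)
  -- the abstract lemma
  have hc' : (c : ℤ) ≠ 0 := by exact_mod_cast hc
  obtain ⟨t, hct, hδt, hth⟩ :=
    abstract_takahashi (Brandt.weight S.O) g m (c : ℤ) (P.modularDegree : ℤ) hc' hνν (hdiv g hgsum)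
      ⟨x₀, hx₀⟩
  -- `ξ_S = ⟨g, g⟩`
  have hxi : (S.xi (fun n => W.LFunction n) : ℤ) = pair (Brandt.weight S.O) g g := by
    rw [Brandt.XiSetup.xi, Brandt.xiOfOrder_eq, Brandt.xi_eq_sum _ hg0 hL, pair_self_eq_natCast]
  refine ⟨t.natAbs, m.natAbs, ?_, ?_, ?_, ?_⟩
  · rw [Int.natAbs_pos]
    rintro rfl
    rw [mul_zero] at hct
    exact hc' hct
  · have : (c : ℤ).natAbs = (m * t).natAbs := by rw [hct]
    rw [Int.natAbs_natCast, Int.natAbs_mul] at this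
    rw [this, mul_comm]
  · have hxi' : (S.xi fun n => W.LFunction n) = (pair (Brandt.weight S.O) g g).natAbs := by
      rw [← hxi, Int.natAbs_natCast]
    rw [hxi']
    exact Int.natAbs_dvd_natAbs.mpr hth
  · have key := congrArg Int.natAbs hδt
    rw [Int.natAbs_mul, Int.natAbs_mul, Int.natAbs_natCast, ← hxi, Int.natAbs_natCast] at key
    exact key

end Summit.ABC.ABC.Cruxes.DefiniteRTControlPrime.Sketch

end
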